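import Summits.NavierStokesRegularity.FunctionalMining.NoGo.StrainMomentLtTwoLine
import Summits.NavierStokesRegularity.FunctionalMining.StrainMomentRegWeight
import Summits.NavierStokesRegularity.FunctionalMining.NoGo.TopBotEigHeatCoerciveTwoSharp
import HarnessLib

/-!
# FunctionalMining / NoGo — K11c (3/4): the QUANTITATIVE viscous sign for the regularised weight
# (`1 ≤ q ≤ 2`, factor `q − 1`) and the regularised nonlinear Poincaré inequality for the strain,
# `1 < q < 2`

HONEST FRAMING. Search for candidate a priori estimates; no regularity claim. Nothing about
Navier–Stokes is proved or asserted in this file: inequalities for smooth vector fields on the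
flat torus along the HEAT line `v + tΔv` (no transport term, no pressure) and lemmas of real
analysis. Cell `pub-nsfunc`, no-go seat (gen 39). K11 = FOUR files, imported in this order: K11a
`NoGo/StrainMomentLtTwoRadial` → K11b `NoGo/StrainMomentLtTwoLine` → K11c `NoGo/StrainMomentLtTwoReg`
→ K11d `NoGo/StrainMomentHeatCoerciveLtTwo` (the row); K12 = `NoGo/TopBotEigHeatCoerciveLtTwo`.

THE TARGET (K11d). The tree proves the heat row of the strain moment `Z_q = torusStrainMoment q =
∫|S|^q` — `TopEig.HeatCoercive Z_q c`: `c·Z_q(v) ≤ heatDissipation Z_q v = −(d/dt)⁺Z_q(v+tΔv)|₀` on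
smooth divergence-free `v` — for real `q > 2` (`TopEigStrainHeatLine`, through the weighted
dissipation `D_Z = ∫|S|^{q−2}|∇S|²` and `npConst q`) and at `q = 2` (K7/K8). BELOW `q = 2` the weight
`|S|^{q−2}` is singular on `{S = 0}` and no `D_Z` is available; K11 proves the row for EVERY REAL
`1 < q < 2` without ever forming a weighted dissipation at `ε = 0`:
`TopEig.strainMoment_heatCoercive_of_lt_two (hq1 : 1 < q) (hq2 : q < 2) : HeatCoercive Z_q (c_Z q)`,
`c_Z q = TopEig.zqRateLtTwo q = 2π²q(q−1)/(51(2−q/2)²)` (not sharp), in FIELD FORM (every smooth `v`).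
K12 re-runs K9's mixture principle with this row: `TopBotEigSplitting q c → 0 < c →
TopBotEigHeatCoercivePos q` for `1 < q < 2` (door D-K6 (c) below `q = 2` REDUCED to the splitting, which
is NOT proved below `q = 2`).

WHAT IS PROVED HERE [ours]:
* §6 (`T^d`, smooth `v`, `ε > 0`, real `1 ≤ q ≤ 2`) **`TopEig.viscous_reg_le`** /
  **`TopEig.integral_reg_strain_laplacian_le`**:
  `∫(|S|²+ε)^{q/2−1}ΣᵢⱼSᵢⱼ(∂ᵢΔv)ⱼ ≤ −(q−1)·∫(|S|²+ε)^{q/2−1}Σₖᵢⱼ(∂ₖSᵢⱼ)²` — the quantitative form of the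
  tree's `StrainMoment.viscous_reg_nonpos` (`≤ 0`): the same integration by parts
  (`GradientTensor.integral_deriv_comp_strainSqAt_mul_sum_strain_laplacian`) and Kato bound
  (`StrainMoment.sum_partialDeriv_strainSqAt_sq_le`), keeping the `p`-Laplacian factor `q − 1`.
* §7 (`T³`, `b = q/2 − 1`) **`TopEig.strainMoment_le_reg_of_lt_two (hq1 : 1 < q) (hq2 : q < 2) (hε : 0 < ε)`**:
  `Z_q(v) ≤ 204·∫‖(‖S‖²+ε)^{b/2}S − (‖S‖²)^{b/2}S‖² + (51/(2π²))(2−q/2)²·∫(|S|²+ε)^bΣₖᵢⱼ(∂ₖSᵢⱼ)²`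
  (K11b's mean control and gradient bound, three-term splitting, and K8's SHARP Poincaré–Wirtinger
  `TopEig.four_pi_sq_mul_integral_norm_sq_le_dirichlet`).

WHAT IS NOT PROVED HERE. The limit `ε → 0` and the row: K11d. No constant is sharp.

PROVENANCE / STATUS. Typed and farm-checked by the no-go seat (gen 39): K11a stand-alone, the others as
concatenations with the union of their tree imports (evidence `pub-nsfunc-nogo/sieveld/kth/`: check
JSONs, a negative control, the by-value file `zqRateLtTwo (3/2) = 8π²/425`). STATUS: STAGED
(`pub-nsfunc-nogo/NoGo/<name>.STAGING.lean`); filing by a prove seat on the lead's word in the order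
K11a → K11b → K11c → K11d → K12, after K8 `NoGo/TopBotEigHeatCoerciveTwoSharp` and K9
`NoGo/TopBotEigHeatCoerciveSplit` (both in the tree); the planner seat cannot file under
`FunctionalMining/`. No constant is claimed sharp. Search for candidate a priori estimates; no
regularity claim. [ours; K1-Q6 = door D-K6, heat side, `1 < q < 2`]
FILING (prove seat g26, REQUEST #25c): declarations byte-identical to the no-go seat's staged `StrainMomentLtTwoReg.STAGING.lean` d90c999b79053659; this line is the only addition.
-/

noncomputable section

open MeasureTheory Finset Set Filter Topology
open scoped InnerProductSpace RealInnerProductSpace ContDiff Real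

namespace Summit.NavierStokesRegularity.FunctionalMining

open Literature.Analysis.FunctionSpaces Literature.Analysis.FunctionSpaces.Torus
  Literature.Analysis.FluidPDE

namespace TopEig

open StrainL4 StrainMoment

/-! ## 6. The quantitative viscous sign for the regularised weight, `1 ≤ q ≤ 2` -/

/-- **`∫ Ψ_ε'(|S|²)∑ᵢⱼSᵢⱼ(∂ᵢΔv)ⱼ ≤ −(q − 1) ∫ Ψ_ε'(|S|²)∑ₖ∑ᵢⱼ(∂ₖSᵢⱼ)²`** for smooth `v` on `T^d`,
`ε > 0`, real `1 ≤ q ≤ 2`, `Ψ_ε(y) = (y + ε)^{q/2}`: the quantitative form of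
`StrainMoment.viscous_reg_nonpos` (by parts the left side is `−∫Ψ_ε'|∇S|² − ½∫Ψ_ε''∑ₖ(∂ₖ|S|²)²`,
and the Kato bound with `2|Ψ_ε''(y)|y ≤ (2 − q)Ψ_ε'(y)` gives `−½∫Ψ_ε''∑ₖ(∂ₖ|S|²)² ≤ (2−q)∫Ψ_ε'|∇S|²`;
the `p`-Laplacian-type absorption keeps the factor `q − 1`). [ours] -/
theorem viscous_reg_le {d : Type*} [Fintype d] [DecidableEq d]
    {v : UnitAddTorus d → EuclideanSpace ℝ d} (hv : Torus.IsSmooth v) {ε q : ℝ} (hε : 0 < ε)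
    (hq1 : 1 ≤ q) (hq2 : q ≤ 2) :
    ∫ x, deriv (fun y : ℝ => (y + ε) ^ (q / 2)) (torusStrainSqAt v x) * ∑ i, ∑ j,
        (Torus.partialDeriv j v x i + Torus.partialDeriv i v x j) / 2 *
          Torus.partialDeriv i (Torus.laplacian v) x j ≤
      -((q - 1) * ∫ x, deriv (fun y : ℝ => (y + ε) ^ (q / 2)) (torusStrainSqAt v x) *
        ∑ k, ∑ i, ∑ j, ((Torus.partialDeriv k (Torus.partialDeriv j v) x i +
          Torus.partialDeriv k (Torus.partialDeriv i v) x j) / 2) ^ 2) := by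
  have hQ0 : ∀ x, 0 ≤ torusStrainSqAt v x := torusStrainSqAt_nonneg v
  have hpos : ∀ x, 0 < torusStrainSqAt v x + ε := fun x => by linarith [hQ0 x]
  have hmaps : ∀ x, torusStrainSqAt v x ∈ Ioi (-ε) := fun x => by
    show -ε < torusStrainSqAt v x; linarith [hQ0 x]
  have hid := GradientTensor.integral_deriv_comp_strainSqAt_mul_sum_strain_laplacian hv isOpen_Ioi
    (contDiffOn_rpow_add ε (q / 2)) hmaps
  rw [hid]
  set D2 : UnitAddTorus d → ℝ := fun x => ∑ k, ∑ i, ∑ j,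
    ((Torus.partialDeriv k (Torus.partialDeriv j v) x i +
      Torus.partialDeriv k (Torus.partialDeriv i v) x j) / 2) ^ 2 with hD2
  set KK : UnitAddTorus d → ℝ := fun x => ∑ k, Torus.partialDeriv k (torusStrainSqAt v) x ^ 2
    with hKK
  have hD20 : ∀ x, 0 ≤ D2 x := fun x => Finset.sum_nonneg fun k _ => Finset.sum_nonneg fun i _ =>
    Finset.sum_nonneg fun j _ => sq_nonneg _
  have hKato : ∀ x, KK x ≤ 4 * torusStrainSqAt v x * D2 x := fun x =>
    sum_partialDeriv_strainSqAt_sq_le hv x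
  have hw1 : ∀ x, deriv (fun y : ℝ => (y + ε) ^ (q / 2)) (torusStrainSqAt v x) =
      q / 2 * (torusStrainSqAt v x + ε) ^ (q / 2 - 1) := fun x => deriv_rpow_add (hpos x)
  have hw2 : ∀ x, deriv (deriv (fun y : ℝ => (y + ε) ^ (q / 2))) (torusStrainSqAt v x) =
      q / 2 * (q / 2 - 1) * (torusStrainSqAt v x + ε) ^ (q / 2 - 2) := fun x =>
    deriv_deriv_rpow_add (hpos x)
  -- pointwise: `−½ Ψ'' K ≤ (2 − q) Ψ' D2`
  have hpt : ∀ x, -(2⁻¹ * (deriv (deriv (fun y : ℝ => (y + ε) ^ (q / 2))) (torusStrainSqAt v x) *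
      KK x)) ≤ (2 - q) * (deriv (fun y : ℝ => (y + ε) ^ (q / 2)) (torusStrainSqAt v x) * D2 x) := by
    intro x
    rw [hw1 x, hw2 x]
    set y := torusStrainSqAt v x with hy
    have hy0 : 0 ≤ y := hQ0 x
    have hyε : 0 < y + ε := hpos x
    have hA2 : 0 ≤ (y + ε) ^ (q / 2 - 2) := Real.rpow_nonneg hyε.le _
    have hsplit : (y + ε) ^ (q / 2 - 1) = (y + ε) ^ (q / 2 - 2) * (y + ε) := by
      rw [show q / 2 - 1 = (q / 2 - 2) + 1 by ring, Real.rpow_add hyε, Real.rpow_one]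
    have hc : 0 ≤ q / 2 * (1 - q / 2) := mul_nonneg (by linarith) (by linarith)
    have h1 : -(2⁻¹ * (q / 2 * (q / 2 - 1) * (y + ε) ^ (q / 2 - 2) * KK x)) =
        2⁻¹ * (q / 2 * (1 - q / 2) * (y + ε) ^ (q / 2 - 2)) * KK x := by ring
    have h2 : 2⁻¹ * (q / 2 * (1 - q / 2) * (y + ε) ^ (q / 2 - 2)) * KK x ≤
        2⁻¹ * (q / 2 * (1 - q / 2) * (y + ε) ^ (q / 2 - 2)) * (4 * y * D2 x) :=
      mul_le_mul_of_nonneg_left (hKato x) (mul_nonneg (by norm_num) (mul_nonneg hc hA2))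
    have h3 : 2⁻¹ * (q / 2 * (1 - q / 2) * (y + ε) ^ (q / 2 - 2)) * (4 * y * D2 x) ≤
        (2 - q) * (q / 2 * (y + ε) ^ (q / 2 - 1) * D2 x) := by
      rw [hsplit]
      have h4 : y ≤ y + ε := by linarith
      have h5 : 2⁻¹ * (q / 2 * (1 - q / 2) * (y + ε) ^ (q / 2 - 2)) * (4 * y * D2 x) =
          (2 - q) * (q / 2 * ((y + ε) ^ (q / 2 - 2) * y) * D2 x) := by ring
      rw [h5]
      have h6 : q / 2 * ((y + ε) ^ (q / 2 - 2) * y) * D2 x ≤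
          q / 2 * ((y + ε) ^ (q / 2 - 2) * (y + ε)) * D2 x :=
        mul_le_mul_of_nonneg_right (mul_le_mul_of_nonneg_left
          (mul_le_mul_of_nonneg_left h4 hA2) (by linarith)) (hD20 x)
      exact mul_le_mul_of_nonneg_left h6 (by linarith)
    linarith
  -- integrate
  have hQc : Continuous (torusStrainSqAt v) := continuous_strainSqAt hv
  have hD2c : Continuous D2 :=
    continuous_finsetSum _ fun k _ => continuous_finsetSum _ fun i _ =>
      continuous_finsetSum _ fun j _ =>
        (((((hv.partialDeriv j).partialDeriv k).apply i).add
          (((hv.partialDeriv i).partialDeriv k).apply j)).continuous.div_const _).pow 2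
  have hcA : Continuous fun x => (2 - q) *
      (deriv (fun y : ℝ => (y + ε) ^ (q / 2)) (torusStrainSqAt v x) * D2 x) := by
    have e : (fun x => (2 - q) * (deriv (fun y : ℝ => (y + ε) ^ (q / 2)) (torusStrainSqAt v x) *
        D2 x)) = fun x => (2 - q) * (q / 2 * (torusStrainSqAt v x + ε) ^ (q / 2 - 1) * D2 x) :=
      funext fun x => by rw [hw1 x]
    rw [e]
    exact ((continuous_const.mul ((hQc.add continuous_const).rpow_const fun x =>
      Or.inl (hpos x).ne')).mul hD2c).const_mul _
  have hcB : Continuous fun x => deriv (deriv (fun y : ℝ => (y + ε) ^ (q / 2)))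
      (torusStrainSqAt v x) * KK x := by
    have e : (fun x => deriv (deriv (fun y : ℝ => (y + ε) ^ (q / 2))) (torusStrainSqAt v x) * KK x) =
        fun x => q / 2 * (q / 2 - 1) * (torusStrainSqAt v x + ε) ^ (q / 2 - 2) * KK x :=
      funext fun x => by rw [hw2 x]
    rw [e]
    refine (continuous_const.mul ((hQc.add continuous_const).rpow_const fun x =>
      Or.inl (hpos x).ne')).mul ?_
    exact continuous_finsetSum _ fun k _ =>
      ((GradientTensor.isSmooth_strainSqAt hv).partialDeriv k).continuous.pow 2
  have hle : ∫ x, -(2⁻¹ * (deriv (deriv (fun y : ℝ => (y + ε) ^ (q / 2))) (torusStrainSqAt v x) *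
      KK x)) ≤ ∫ x, (2 - q) *
        (deriv (fun y : ℝ => (y + ε) ^ (q / 2)) (torusStrainSqAt v x) * D2 x) :=
    integral_mono ((hcB.const_mul _).neg).integrable_unitAddTorus hcA.integrable_unitAddTorus
      fun x => hpt x
  rw [integral_neg, integral_const_mul, integral_const_mul] at hle
  simp only [hD2, hKK] at hle
  linarith

/-- The same in explicit form: for `ε > 0` and real `1 ≤ q ≤ 2`,
`∫ (|S|²+ε)^{q/2−1} ∑ᵢⱼSᵢⱼ(∂ᵢΔv)ⱼ ≤ −(q−1) ∫ (|S|²+ε)^{q/2−1} ∑ₖ∑ᵢⱼ(∂ₖSᵢⱼ)²`. [ours] -/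
theorem integral_reg_strain_laplacian_le {d : Type*} [Fintype d] [DecidableEq d]
    {v : UnitAddTorus d → EuclideanSpace ℝ d} (hv : Torus.IsSmooth v) {ε q : ℝ} (hε : 0 < ε)
    (hq1 : 1 ≤ q) (hq2 : q ≤ 2) :
    ∫ x, (torusStrainSqAt v x + ε) ^ (q / 2 - 1) * ∑ i, ∑ j,
        (Torus.partialDeriv j v x i + Torus.partialDeriv i v x j) / 2 *
          Torus.partialDeriv i (Torus.laplacian v) x j ≤
      -((q - 1) * ∫ x, (torusStrainSqAt v x + ε) ^ (q / 2 - 1) *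
        ∑ k, ∑ i, ∑ j, ((Torus.partialDeriv k (Torus.partialDeriv j v) x i +
          Torus.partialDeriv k (Torus.partialDeriv i v) x j) / 2) ^ 2) := by
  have hQ0 : ∀ x, 0 ≤ torusStrainSqAt v x := torusStrainSqAt_nonneg v
  have hpos : ∀ x, 0 < torusStrainSqAt v x + ε := fun x => by linarith [hQ0 x]
  have hw1 : ∀ x, deriv (fun y : ℝ => (y + ε) ^ (q / 2)) (torusStrainSqAt v x) =
      q / 2 * (torusStrainSqAt v x + ε) ^ (q / 2 - 1) := fun x => deriv_rpow_add (hpos x)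
  have h := viscous_reg_le hv hε hq1 hq2
  have eA : ∫ x, deriv (fun y : ℝ => (y + ε) ^ (q / 2)) (torusStrainSqAt v x) * ∑ i, ∑ j,
      (Torus.partialDeriv j v x i + Torus.partialDeriv i v x j) / 2 *
        Torus.partialDeriv i (Torus.laplacian v) x j =
      q / 2 * ∫ x, (torusStrainSqAt v x + ε) ^ (q / 2 - 1) * ∑ i, ∑ j,
        (Torus.partialDeriv j v x i + Torus.partialDeriv i v x j) / 2 *
          Torus.partialDeriv i (Torus.laplacian v) x j := by
    rw [← integral_const_mul]
    refine integral_congr_ae (ae_of_all _ fun x => ?_)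
    simp only
    rw [hw1 x]; ring
  have eB : ∫ x, deriv (fun y : ℝ => (y + ε) ^ (q / 2)) (torusStrainSqAt v x) *
      ∑ k, ∑ i, ∑ j, ((Torus.partialDeriv k (Torus.partialDeriv j v) x i +
        Torus.partialDeriv k (Torus.partialDeriv i v) x j) / 2) ^ 2 =
      q / 2 * ∫ x, (torusStrainSqAt v x + ε) ^ (q / 2 - 1) *
        ∑ k, ∑ i, ∑ j, ((Torus.partialDeriv k (Torus.partialDeriv j v) x i +
          Torus.partialDeriv k (Torus.partialDeriv i v) x j) / 2) ^ 2 := by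
    rw [← integral_const_mul]
    refine integral_congr_ae (ae_of_all _ fun x => ?_)
    simp only
    rw [hw1 x]; ring
  rw [eA, eB] at h
  have hq0 : 0 < q / 2 := by linarith
  refine le_of_mul_le_mul_left ?_ hq0
  linarith

/-! ## 7. The regularised nonlinear Poincaré inequality for the strain, `1 < q < 2` -/

/-- **Regularised nonlinear Poincaré for the strain moment below `q = 2`.** For `1 < q < 2`, smooth
`v` on `T³`, `ε > 0`, with `b = q/2 − 1 ∈ (−1/2, 0)`, `S = strainFlat v`, `W = (‖S‖²)^{b/2}S`,
`W_ε = (‖S‖²+ε)^{b/2}S`: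
`Z_q(v) ≤ 204 ∫‖W_ε − W‖² + (51/(2π²)) (2 − q/2)² ∫ (|S|²+ε)^b ∑ₖ∑ᵢⱼ(∂ₖSᵢⱼ)²`
(`Z_q = ∫‖W‖²`; mean control `‖∫W‖² ≤ 16 ∫‖W − ∫W‖²` because `S = ‖W‖^γ W`, `γ = −b/(1+b) ∈ (0,1)`,
has zero mean; three-term splitting through `W_ε`; sharp Poincaré–Wirtinger
`four_pi_sq_mul_integral_norm_sq_le_dirichlet` for `W_ε − ∫W_ε` and the regularised gradient bound
`(1 + |b|)²`). The error term is a parametric integral vanishing at `ε = 0`. [ours] -/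
theorem strainMoment_le_reg_of_lt_two {q : ℝ} (hq1 : 1 < q) (hq2 : q < 2)
    {v : UnitAddTorus (Fin 3) → EuclideanSpace ℝ (Fin 3)} (hv : Torus.IsSmooth v) {ε : ℝ}
    (hε : 0 < ε) :
    torusStrainMoment q v ≤
      204 * (∫ x, ‖(‖strainFlat v x‖ ^ 2 + ε) ^ ((q / 2 - 1) / 2) • strainFlat v x -
          (‖strainFlat v x‖ ^ 2) ^ ((q / 2 - 1) / 2) • strainFlat v x‖ ^ 2) +
      51 / (2 * π ^ 2) * (2 - q / 2) ^ 2 * ∫ x, (torusStrainSqAt v x + ε) ^ (q / 2 - 1) *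
        ∑ k, ∑ i, ∑ j, ((Torus.partialDeriv k (Torus.partialDeriv j v) x i +
          Torus.partialDeriv k (Torus.partialDeriv i v) x j) / 2) ^ 2 := by
  obtain ⟨b, hb⟩ : ∃ b : ℝ, b = q / 2 - 1 := ⟨_, rfl⟩
  have hb1 : -1 / 2 < b := by rw [hb]; linarith
  have hb2 : b < 0 := by rw [hb]; linarith
  have hb3 : -1 / 2 < b / 2 := by linarith
  rw [← hb]
  set S : UnitAddTorus (Fin 3) → EuclideanSpace ℝ (Fin 3 × Fin 3) := strainFlat v with hSdef
  have hS : Torus.IsSmooth S := isSmooth_strainFlat hv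
  have hS0 : Torus.HasZeroMean S := hasZeroMean_strainFlat hv
  have hSc : Continuous S := hS.continuous
  set W : UnitAddTorus (Fin 3) → EuclideanSpace ℝ (Fin 3 × Fin 3) :=
    fun x => (‖S x‖ ^ 2) ^ (b / 2) • S x with hW
  set Wε : UnitAddTorus (Fin 3) → EuclideanSpace ℝ (Fin 3 × Fin 3) :=
    fun x => (‖S x‖ ^ 2 + ε) ^ (b / 2) • S x with hWε
  have hWc : Continuous W := (continuous_rpow_normSq_smul hb3).comp hSc
  have hWεs : Torus.IsSmooth Wε := CodomainNP.isSmooth_regA hS hε (b / 2)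
  have hWεc : Continuous Wε := hWεs.continuous
  set c : EuclideanSpace ℝ (Fin 3 × Fin 3) := ∫ x, W x with hc
  set cε : EuclideanSpace ℝ (Fin 3 × Fin 3) := ∫ x, Wε x with hcε
  set V : ℝ := ∫ x, ‖W x - c‖ ^ 2 with hV
  set P : ℝ := ∫ x, ‖Wε x - W x‖ ^ 2 with hP
  set J : ℝ := ∫ x, (torusStrainSqAt v x + ε) ^ b *
    ∑ k, ∑ i, ∑ j, ((Torus.partialDeriv k (Torus.partialDeriv j v) x i +
      Torus.partialDeriv k (Torus.partialDeriv i v) x j) / 2) ^ 2 with hJ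
  have hV0 : 0 ≤ V := integral_nonneg fun x => sq_nonneg _
  have hP0 : 0 ≤ P := integral_nonneg fun x => sq_nonneg _
  -- (1) `Z_q = ∫‖W‖²`
  have hZ : torusStrainMoment q v = ∫ x, ‖W x‖ ^ 2 := by
    show (∫ x, torusStrainSqAt v x ^ (q / 2)) = _
    refine integral_congr_ae (ae_of_all _ fun x => ?_)
    show torusStrainSqAt v x ^ (q / 2) = ‖(‖S x‖ ^ 2) ^ (b / 2) • S x‖ ^ 2
    rw [norm_rpow_normSq_smul_sq (by rw [hb]; linarith), hSdef, norm_strainFlat_sq]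
    congr 1; rw [hb]; ring
  -- (2) mean control: `‖c‖² ≤ 16 V`
  have hmean : ‖c‖ ^ 2 ≤ 16 * V := by
    obtain ⟨γ, hγ⟩ : ∃ γ : ℝ, γ = -b / (1 + b) := ⟨_, rfl⟩
    have h1b : 0 < 1 + b := by linarith
    have hγ0 : 0 ≤ γ := by rw [hγ]; exact div_nonneg (by linarith) h1b.le
    have hγ1 : γ ≤ 1 := by rw [hγ, div_le_one h1b]; linarith
    have hγb : γ * (1 + b) = -b := by rw [hγ]; field_simp
    have h0 : ∫ x, ‖W x‖ ^ γ • W x = 0 := by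
      have e : (fun x => ‖W x‖ ^ γ • W x) = S := funext fun x => rpow_smul_rpow_normSq_smul hγb (S x)
      rw [e]; exact hS0
    have h := norm_integral_le_of_rpow_smul_mean_zero hWc hγ0 hγ1 h0
    have h2 : ‖c‖ ^ 2 ≤ (4 * Real.sqrt V) ^ 2 := pow_le_pow_left₀ (norm_nonneg _) h 2
    rw [mul_pow, Real.sq_sqrt hV0] at h2
    linarith
  -- (3) `∫‖W‖² ≤ 34 V`
  have hUV : ∫ x, ‖W x‖ ^ 2 ≤ 34 * V := by
    have hpt : ∀ x, ‖W x‖ ^ 2 ≤ 2 * ‖W x - c‖ ^ 2 + 2 * ‖c‖ ^ 2 := by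
      intro x
      have h := norm_add_le (W x - c) c
      rw [sub_add_cancel] at h
      have h2 : ‖W x‖ ^ 2 ≤ (‖W x - c‖ + ‖c‖) ^ 2 := pow_le_pow_left₀ (norm_nonneg _) h 2
      nlinarith [sq_nonneg (‖W x - c‖ - ‖c‖)]
    have hiV : Integrable (fun x => 2 * ‖W x - c‖ ^ 2) volume :=
      (((hWc.sub continuous_const).norm.pow 2).const_mul 2).integrable_unitAddTorus
    have hic : Integrable (fun _ : UnitAddTorus (Fin 3) => 2 * ‖c‖ ^ 2) volume := integrable_const _
    calc ∫ x, ‖W x‖ ^ 2 ≤ ∫ x, (2 * ‖W x - c‖ ^ 2 + 2 * ‖c‖ ^ 2) :=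
          integral_mono (hWc.norm.pow 2).integrable_unitAddTorus (hiV.add hic) hpt
      _ = 2 * V + 2 * ‖c‖ ^ 2 := by
          rw [integral_add hiV hic, integral_const_mul, integral_const]
          simp [hV]
      _ ≤ 34 * V := by linarith
  -- (4) `‖cε − c‖² ≤ P`
  have hcc : ‖cε - c‖ ^ 2 ≤ P := by
    have e : cε - c = ∫ x, (Wε x - W x) := by
      rw [hcε, hc, integral_sub hWεc.integrable_unitAddTorus hWc.integrable_unitAddTorus]
    have h1 : ‖cε - c‖ ≤ ∫ x, ‖Wε x - W x‖ := by rw [e]; exact norm_integral_le_integral_norm _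
    have h2 : ∫ x, ‖Wε x - W x‖ ≤ Real.sqrt P :=
      VelocityL4.integral_le_sqrt_integral_sq (hWεc.sub hWc).norm
    calc ‖cε - c‖ ^ 2 ≤ Real.sqrt P ^ 2 := pow_le_pow_left₀ (norm_nonneg _) (h1.trans h2) 2
      _ = P := Real.sq_sqrt hP0
  -- (5) sharp Poincaré–Wirtinger for `Wε − cε` and the regularised gradient bound
  have hPW : 4 * π ^ 2 * ∫ x, ‖Wε x - cε‖ ^ 2 ≤ (1 + |b|) ^ 2 * J := by
    have hsm : Torus.IsSmooth (fun x => Wε x - cε) := hWεs.sub (isSmooth_const cε)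
    have hzm : Torus.HasZeroMean (fun x => Wε x - cε) := by
      show ∫ x, (Wε x - cε) = 0
      rw [integral_sub hWεc.integrable_unitAddTorus (integrable_const _), integral_const]
      simp [hcε]
    have h1 := four_pi_sq_mul_integral_norm_sq_le_dirichlet (0 : Fin 3) hsm hzm
    have hg : ∫ x, ∑ k, ‖Torus.partialDeriv k (fun x => Wε x - cε) x‖ ^ 2 =
        ∫ x, ∑ k, ‖Torus.partialDeriv k Wε x‖ ^ 2 := by
      refine integral_congr_ae (ae_of_all _ fun x => ?_)
      refine Finset.sum_congr rfl fun k _ => ?_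
      have e : (fun x => Wε x - cε) = Wε + fun _ => -cε := by
        funext y; simp [sub_eq_add_neg]
      have hcst : Torus.IsContDiff 1 (fun _ : UnitAddTorus (Fin 3) => -cε) := contDiff_const
      rw [e, Torus.partialDeriv_add (hWεs.isContDiff (by simp)) hcst, Pi.add_apply]
      simp [Torus.partialDeriv, Torus.lineDeriv]
    have hG : ∫ x, ∑ k, ‖Torus.partialDeriv k Wε x‖ ^ 2 ≤
        (1 + |b|) ^ 2 * ∫ x, (‖S x‖ ^ 2 + ε) ^ b * ∑ k, ‖Torus.partialDeriv k S x‖ ^ 2 :=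
      dirichlet_regA_le_abs hS b hε
    have hJ' : ∫ x, (‖S x‖ ^ 2 + ε) ^ b * ∑ k, ‖Torus.partialDeriv k S x‖ ^ 2 = J := by
      refine integral_congr_ae (ae_of_all _ fun x => ?_)
      show (‖S x‖ ^ 2 + ε) ^ b * ∑ k, ‖Torus.partialDeriv k S x‖ ^ 2 = _
      rw [hSdef, norm_strainFlat_sq, sum_norm_partialDeriv_strainFlat_sq hv x]
    rw [hg] at h1
    rw [hJ'] at hG
    exact h1.trans hG
  -- (6) three-term splitting
  have hsplit : V ≤ 3 * P + 3 * (∫ x, ‖Wε x - cε‖ ^ 2) + 3 * ‖cε - c‖ ^ 2 := by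
    have hpt : ∀ x, ‖W x - c‖ ^ 2 ≤
        3 * ‖Wε x - W x‖ ^ 2 + 3 * ‖Wε x - cε‖ ^ 2 + 3 * ‖cε - c‖ ^ 2 := by
      intro x
      have e : W x - c = (Wε x - cε) + (cε - c) - (Wε x - W x) := by abel
      have h1 := norm_sub_le ((Wε x - cε) + (cε - c)) (Wε x - W x)
      have h2 := norm_add_le (Wε x - cε) (cε - c)
      rw [← e] at h1
      have h3 : ‖W x - c‖ ≤ ‖Wε x - W x‖ + ‖Wε x - cε‖ + ‖cε - c‖ := by linarith
      have h4 : ‖W x - c‖ ^ 2 ≤ (‖Wε x - W x‖ + ‖Wε x - cε‖ + ‖cε - c‖) ^ 2 :=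
        pow_le_pow_left₀ (norm_nonneg _) h3 2
      nlinarith [sq_nonneg (‖Wε x - W x‖ - ‖Wε x - cε‖), sq_nonneg (‖Wε x - cε‖ - ‖cε - c‖),
        sq_nonneg (‖Wε x - W x‖ - ‖cε - c‖)]
    have hca : Continuous fun x => ‖Wε x - W x‖ ^ 2 := (hWεc.sub hWc).norm.pow 2
    have hcb : Continuous fun x => ‖Wε x - cε‖ ^ 2 := (hWεc.sub continuous_const).norm.pow 2
    have hia : Integrable (fun x => 3 * ‖Wε x - W x‖ ^ 2) volume :=
      (hca.const_mul 3).integrable_unitAddTorus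
    have hib : Integrable (fun x => 3 * ‖Wε x - cε‖ ^ 2) volume :=
      (hcb.const_mul 3).integrable_unitAddTorus
    have hicc : Integrable (fun _ : UnitAddTorus (Fin 3) => 3 * ‖cε - c‖ ^ 2) volume :=
      integrable_const _
    have hiab : Integrable (fun x => 3 * ‖Wε x - W x‖ ^ 2 + 3 * ‖Wε x - cε‖ ^ 2) volume :=
      hia.add hib
    have hiV : Integrable (fun x => ‖W x - c‖ ^ 2) volume :=
      ((hWc.sub continuous_const).norm.pow 2).integrable_unitAddTorus
    calc V ≤ ∫ x, (3 * ‖Wε x - W x‖ ^ 2 + 3 * ‖Wε x - cε‖ ^ 2 + 3 * ‖cε - c‖ ^ 2) :=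
          integral_mono hiV (hiab.add hicc) hpt
      _ = 3 * P + 3 * (∫ x, ‖Wε x - cε‖ ^ 2) + 3 * ‖cε - c‖ ^ 2 := by
          rw [integral_add hiab hicc, integral_add hia hib, integral_const_mul, integral_const_mul,
            integral_const]
          simp [hP]
  -- (7) combine
  have hπ : 0 < 4 * π ^ 2 := by positivity
  have hX : ∫ x, ‖Wε x - cε‖ ^ 2 ≤ (1 + |b|) ^ 2 * J / (4 * π ^ 2) := by
    rw [le_div_iff₀ hπ]; linarith
  have hab : 1 + |b| = 2 - q / 2 := by rw [abs_of_neg hb2, hb]; ring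
  have hVle : V ≤ 6 * P + 3 * ((1 + |b|) ^ 2 * J / (4 * π ^ 2)) := by linarith
  calc torusStrainMoment q v = ∫ x, ‖W x‖ ^ 2 := hZ
    _ ≤ 34 * V := hUV
    _ ≤ 34 * (6 * P + 3 * ((1 + |b|) ^ 2 * J / (4 * π ^ 2))) := by linarith
    _ = 204 * P + 51 / (2 * π ^ 2) * (1 + |b|) ^ 2 * J := by
        field_simp
        ring
    _ = 204 * P + 51 / (2 * π ^ 2) * (2 - q / 2) ^ 2 * J := by rw [hab]

end TopEig

end Summit.NavierStokesRegularity.FunctionalMining
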